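import Literature.AnabelianGeometry.EtaleTheta.ThetaCyclotomes
import Literature.AnabelianGeometry.EtaleTheta.SettingGaloisFacts
import Mathlib.Data.ZMod.QuotientGroup
import HarnessLib

/-!
# [EtTh] Def. 2.5 (i)(a) in the §1 model: the covering `X̲ → X` of type `(1, ℤ/lℤ)`

Mochizuki, *The étale theta function and its Frobenioid-theoretic manifestations*, Publ. RIMS **45**
(2009), §2, Def. 2.1 (PRIMS PDF p. 36, printed 262) and Def. 2.5 (i) (p. 39, printed 265): "let
`Π̄^ell_X ↠ Q` be a quotient onto a free `(ℤ/lℤ)`-module `Q` of rank `1` such that the restricted map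
`Δ̄^ell_X → Q` is still surjective, but the restricted map `D_x → Q` is trivial. Denote the
corresponding covering by `X̲^log → X^log`"; Def. 2.5 (i): "Suppose … that the quotient `Π_X ↠ Q`
factors through the natural quotient `Π^tp_X ↠ Z` discussed at the beginning of §1 … Then we shall
say that the orbicurve … is of type `(1, ℤ/lℤ)`" [cite: MochizukiEtTh2009, Def 2.5 (i) p.39].

Cell abc-iut, layer L2, item N3 (existence of the choices of §2 in the §1 model; seat abc-iut-L2-t7),
STAGE 1: in the §1 model (`ThetaSetting p`, seat abc-iut-L2-t1) the condition of Def. 2.5 (i)(a)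
DETERMINES `X̲`: a surjection `Π^tp_X ↠ Q ≅ ℤ/lℤ` factoring through `toZ : Π^tp_X ↠ Z = ℤ` has kernel
`toZ⁻¹(l·ℤ)`. This file DEFINES `Π^tp_X̲ := toZ⁻¹(l·ℤ)` (`ThetaSetting.GtpXu D l`) and PROVES the
printed properties: it is an open normal subgroup of index `l` containing `Π^tp_Y` (`X̲ → X` is a
subcovering of `Y → X`, Galois with group `Z/l·Z`), its image in `Z` is `l·Z` (the shape of
`DoubleUnderline.map_toZ_Huu` one level up), it meets `Δ^tp_X` in a subgroup mapping ONTO `l·ℤ`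
("the restricted map `Δ̄^ell_X → Q` is still surjective": `toZ_delta` is onto), and it maps onto `G_K`
(geometrically connected). NOT carried here: the third clause of Def. 2.1, "the restricted map
`D_x → Q` is trivial" — the §1 root `ThetaSetting` has no carrier for the decomposition group `D_x` of
the cusp inside `Π^tp_X` (in print it holds because `D_x ⊆ Π_Y`, the cusps of `Y` lying over `x`); it
belongs to the second stage together with the choice `X̲̲ → X̲` (t8's `EtaleThetaData.DoubleUnderline`),
which needs inputs beyond the root (cusp decomposition group with a section, the mod-`l` theta
structure); see the seat's report. Nothing here asserts that a `ThetaSetting` exists; typed ≠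
endorsed; no side is taken on any disputed claim.
-/

noncomputable section

namespace Literature.AnabelianGeometry.EtaleTheta

open Literature.AnabelianGeometry.SemiGraphs

namespace ThetaSetting

variable {p : ℕ} [Fact p.Prime] (D : ThetaSetting p) (l : ℕ)

/-- The subgroup `l·Z ⊆ Z = ℤ` (written multiplicatively), the image of `Π^tp_X̲` in `Z`
("`Gal(Y̲̲/X̲̲) (≅ l·ℤ)`", Def. 2.13 (i) p. 47; here for `X̲`). [cite: MochizukiEtTh2009, Def 2.5 (i) p.39] -/
abbrev lZ : Subgroup (Multiplicative ℤ) := Subgroup.zpowers (Multiplicative.ofAdd (l : ℤ))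

/-- **`Π^tp_X̲ := toZ⁻¹(l·Z)`** — the tempered fundamental group of the covering `X̲ → X` of type
`(1, ℤ/lℤ)` in the §1 model: by Def. 2.5 (i)(a) the defining quotient `Π_X ↠ Q ≅ ℤ/lℤ` factors through
`Π^tp_X ↠ Z`, so its kernel is the inverse image of `l·Z`. [cite: MochizukiEtTh2009, Def 2.5 (i) p.39] -/
def GtpXu : Subgroup D.PiTemp := (lZ l).comap D.toZ

/-- `Π^tp_Y ⊆ Π^tp_X̲` (`Y → X̲ → X`: "the quotient … factors through `Π^tp_X ↠ Z`", p. 39).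
[cite: MochizukiEtTh2009, Def 2.5 (i) p.39] -/
theorem GtpY_le_GtpXu : D.GtpY ≤ D.GtpXu l := by
  intro g hg
  have hg' : D.toZ g = 1 := hg
  change D.toZ g ∈ lZ l
  rw [hg']
  exact one_mem _

/-- `Π^tp_X̲` is normal in `Π^tp_X` (`X̲ → X` is Galois, "`Gal(X̲/X) ≅ Q`", Rmk. 2.1.1 p. 36).
[cite: MochizukiEtTh2009, Rmk 2.1.1 p.36] -/
instance GtpXu_normal : (D.GtpXu l).Normal := by
  unfold GtpXu; infer_instance

/-- `Π^tp_X̲` is open in `Π^tp_X` (it contains the open subgroup `Π^tp_Y`).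
[cite: MochizukiEtTh2009, Def 2.5 (i) p.39] -/
theorem isOpen_GtpXu : IsOpen (D.GtpXu l : Set D.PiTemp) :=
  Subgroup.isOpen_mono (D.GtpY_le_GtpXu l) D.isOpen_ker_toZ

/-- The image of `Π^tp_X̲` in `Z` is `l·Z` (`toZ` is onto). [cite: MochizukiEtTh2009, Def 2.5 (i) p.39] -/
theorem map_toZ_GtpXu : (D.GtpXu l).map D.toZ = lZ l :=
  Subgroup.map_comap_eq_self_of_surjective D.toZ_surjective _

/-- **`[Π^tp_X : Π^tp_X̲] = l`** ("`Q` a free `(ℤ/lℤ)`-module of rank `1`", Def. 2.1 p. 36; Rmk. 2.3.1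
"extracting a single copy of `ℤ/lℤ`"). [cite: MochizukiEtTh2009, Def 2.1 p.36] -/
theorem index_GtpXu : (D.GtpXu l).index = l := by
  unfold GtpXu
  rw [Subgroup.index_comap_of_surjective _ D.toZ_surjective]
  have h : lZ l = (AddSubgroup.zmultiples (l : ℤ)).toSubgroup := by
    ext x
    change x ∈ Subgroup.zpowers (Multiplicative.ofAdd (l : ℤ)) ↔
      Multiplicative.toAdd x ∈ AddSubgroup.zmultiples (l : ℤ)
    rw [Subgroup.mem_zpowers_iff, AddSubgroup.mem_zmultiples_iff]
    constructor
    · rintro ⟨k, hk⟩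
      exact ⟨k, by rw [← hk]; simp⟩
    · rintro ⟨k, hk⟩
      refine ⟨k, ?_⟩
      apply Multiplicative.toAdd.injective
      rw [← hk]; simp
  rw [h, AddSubgroup.index_toSubgroup, Int.index_zmultiples]
  simp

/-- **"the restricted map `Δ̄^ell_X → Q` is still surjective"** (Def. 2.1 p. 36) in the model:
`Δ^tp_X` maps ONTO `Z/l·Z`, i.e. `Δ^tp_X · Π^tp_X̲ = Π^tp_X` — from the root axiom "`Δ^tp_X ↠ Z`"
(`toZ_delta_surjective`). [cite: MochizukiEtTh2009, Def 2.1 p.36] -/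
theorem deltaTemp_sup_GtpXu : D.DeltaTemp ⊔ D.GtpXu l = ⊤ := by
  rw [eq_top_iff]
  intro g _
  obtain ⟨⟨d, hd⟩, hdg⟩ := D.toZ_delta_surjective (D.toZ g)
  have hdg' : D.toZ d = D.toZ g := hdg
  -- `g = d * (d⁻¹ g)` with `d ∈ Δ^tp_X` and `toZ (d⁻¹ g) = 0`
  have hmem : d⁻¹ * g ∈ D.GtpXu l := by
    apply D.GtpY_le_GtpXu l
    change D.toZ (d⁻¹ * g) = 1
    rw [map_mul, map_inv, hdg', inv_mul_cancel]
  have : g = d * (d⁻¹ * g) := by group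
  rw [this]
  exact Subgroup.mul_mem _ (Subgroup.mem_sup_left hd) (Subgroup.mem_sup_right hmem)

/-- `Δ^tp_X̲ := Δ^tp_X ∩ Π^tp_X̲` maps onto `l·Z`. [cite: MochizukiEtTh2009, Def 2.1 p.36] -/
theorem map_toZ_deltaTemp_inf_GtpXu : (D.DeltaTemp ⊓ D.GtpXu l).map D.toZ = lZ l := by
  refine le_antisymm ?_ ?_
  · rintro _ ⟨g, ⟨-, hg⟩, rfl⟩
    exact hg
  · intro z hz
    obtain ⟨⟨d, hd⟩, hdz⟩ := D.toZ_delta_surjective z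
    exact ⟨d, ⟨hd, by change D.toZ d ∈ lZ l; rw [show D.toZ d = z from hdz]; exact hz⟩, hdz⟩

/-- `Π^tp_X̲` maps onto `G_K` (`X̲` is geometrically connected over `K`): already `Π^tp_Y` does
(`(Π^tp_{Y₁}).map aug = G_{K₁} = G_K`, root axioms `GtpYN_one`, `map_aug_GtpYN` and `K₁ = K`).
[cite: MochizukiEtTh2009, Def 2.5 (i) p.39] -/
theorem map_aug_GtpXu : (D.GtpXu l).map D.aug.toMonoidHom = D.GK := by
  refine le_antisymm ?_ ?_
  · rintro _ ⟨x, -, rfl⟩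
    exact D.aug_mem_GK x
  · have hY : D.GtpY.map D.aug.toMonoidHom = D.GK := by
      change D.toZ.ker.map _ = _
      rw [← D.GtpYN_one, D.map_aug_GtpYN 1]
      exact D.GKN_one
    rw [← hY]
    exact Subgroup.map_mono (D.GtpY_le_GtpXu l)

/-- The quotient `Π^tp_X/Π^tp_X̲ ≅ Z/l·Z` realised by `toZ` followed by reduction mod `l`: the
homomorphism `Π^tp_X → ℤ/lℤ` ("`Π_X ↠ Q`", Def. 2.1). [cite: MochizukiEtTh2009, Def 2.1 p.36] -/
def toQ : D.PiTemp →* Multiplicative (ZMod l) :=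
  (AddMonoidHom.toMultiplicative (Int.castAddHom (ZMod l))).comp D.toZ

/-- `Ker(Π^tp_X ↠ Q) = Π^tp_X̲`. [cite: MochizukiEtTh2009, Def 2.1 p.36] -/
theorem ker_toQ : (D.toQ l).ker = D.GtpXu l := by
  ext g
  rw [MonoidHom.mem_ker]
  change Multiplicative.ofAdd ((Int.castAddHom (ZMod l)) (Multiplicative.toAdd (D.toZ g))) = 1 ↔
    D.toZ g ∈ lZ l
  rw [← ofAdd_zero, Multiplicative.ofAdd.injective.eq_iff, Int.coe_castAddHom,
    ZMod.intCast_zmod_eq_zero_iff_dvd, Subgroup.mem_zpowers_iff]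
  constructor
  · rintro ⟨k, hk⟩
    refine ⟨k, ?_⟩
    apply Multiplicative.toAdd.injective
    simp [hk, mul_comm]
  · rintro ⟨k, hk⟩
    refine ⟨k, ?_⟩
    rw [← hk]
    simp [mul_comm]

/-- `Π^tp_X ↠ Q` is onto (for `l ≠ 0`). [cite: MochizukiEtTh2009, Def 2.1 p.36] -/
theorem toQ_surjective : Function.Surjective (D.toQ l) := by
  intro q
  obtain ⟨z, hz⟩ := D.toZ_surjective (Multiplicative.ofAdd ((Multiplicative.toAdd q).cast : ℤ))
  refine ⟨z, ?_⟩
  change Multiplicative.ofAdd ((Int.castAddHom (ZMod l)) (Multiplicative.toAdd (D.toZ z))) = q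
  rw [hz]
  simp

end ThetaSetting

end Literature.AnabelianGeometry.EtaleTheta

end
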